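import Summits.Ventures.PercRepro.C041CutGlueBound

/-!
# (INV) is multiplicative along a cut vertex (p6, gen 25; C-041.md §10 (b))

For the glue `glue P ρ₁ ρ₂ Q` (the gadget `P = 𝒫₁`, with reach bits `ρ_t` at the cut vertex `v`, and `Q = 𝒫₂`
beyond `v`): a pair is invalid iff both components are, so `I(glue) = I(P)·I(Q)` (`I_glue`); for a vertex `u″` of
`𝒫₂` with reach bits `ρ′_t` in `Q`, `u″` is reached in the glue iff `v` is reached in `P` and `u″` in `Q`, and
`¬G_t ∧ ρ_t(u″)` factorises: `m_t(glue, ρ_t ∧ ρ′_t) = m_t(P, ρ_t)·m_t(Q, ρ′_t)` (`m₁_glue_right`, `m₂_glue_right`);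
for a vertex `u″` of `𝒫₁` with reach bits `ρ″_t` in `P`, `m_t(glue, ρ″_t) ≥ m_t(P, ρ″_t)·I(Q)` (`m₁_glue_left`,
`m₂_glue_left`: the invalid states of `Q` are among its `¬G_t` states).  Hence (INV) for the pieces gives (INV) for
the glue at every vertex (`INV_glue_right`, `INV_glue_left`) — the block-tree reduction's composition step.
-/

namespace PercRepro

namespace CutGlue

open Finset

variable {Y X : Type*} [Fintype Y] [Fintype X]

open Classical in
/-- A weighted count of a product predicate on the glue factorises. -/
theorem cnt_glue_and (P : Space Y) (ρ₁ ρ₂ : Y → Prop) (Q : Space X) (p : Y → Prop) (q : X → Prop) :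
    (glue P ρ₁ ρ₂ Q).cnt (fun s => p s.1 ∧ q s.2) = P.cnt p * Q.cnt q := by
  unfold Space.cnt
  rw [Fintype.sum_prod_type, Finset.sum_mul_sum]
  apply Finset.sum_congr rfl
  intro σ _
  apply Finset.sum_congr rfl
  intro x _
  rw [glue_w]
  push_cast
  by_cases hp : p σ <;> by_cases hq : q x <;> simp [hp, hq]

/-- `I(glue) = I(P)·I(Q)`: a pair is invalid iff both components are. -/
theorem I_glue (P : Space Y) (ρ₁ ρ₂ : Y → Prop) (Q : Space X) : (glue P ρ₁ ρ₂ Q).I = P.I * Q.I := by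
  unfold Space.I
  rw [← cnt_glue_and]
  apply Space.cnt_congr
  intro s
  rw [glue_V]
  exact not_or

/-- `m₁` at a vertex beyond the cut vertex factorises. -/
theorem m₁_glue_right (P : Space Y) (ρ₁ ρ₂ : Y → Prop) (Q : Space X) (ρ : X → Prop) :
    (glue P ρ₁ ρ₂ Q).m₁ (fun s => ρ₁ s.1 ∧ ρ s.2) = P.m₁ ρ₁ * Q.m₁ ρ := by
  unfold Space.m₁
  rw [← cnt_glue_and]
  apply Space.cnt_congr
  intro s
  rw [glue_G₁]
  tauto

/-- `m₂` at a vertex beyond the cut vertex factorises. -/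
theorem m₂_glue_right (P : Space Y) (ρ₁ ρ₂ : Y → Prop) (Q : Space X) (ρ : X → Prop) :
    (glue P ρ₁ ρ₂ Q).m₂ (fun s => ρ₂ s.1 ∧ ρ s.2) = P.m₂ ρ₂ * Q.m₂ ρ := by
  unfold Space.m₂
  rw [← cnt_glue_and]
  apply Space.cnt_congr
  intro s
  rw [glue_G₂]
  tauto

/-- `m₁` at a vertex of the gadget dominates `m₁(P)·I(Q)`. -/
theorem m₁_glue_left (P : Space Y) (ρ₁ ρ₂ : Y → Prop) (Q : Space X) (ρ : Y → Prop) :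
    P.m₁ ρ * Q.I ≤ (glue P ρ₁ ρ₂ Q).m₁ (fun s => ρ s.1) := by
  unfold Space.m₁ Space.I
  rw [← cnt_glue_and]
  apply Space.cnt_mono
  rintro s ⟨⟨hG, hρ⟩, hV⟩
  refine ⟨?_, hρ⟩
  rw [glue_G₁]
  rintro (h | ⟨_, h⟩)
  · exact hG h
  · exact hV (Q.hG₁ _ h)

/-- `m₂` at a vertex of the gadget dominates `m₂(P)·I(Q)`. -/
theorem m₂_glue_left (P : Space Y) (ρ₁ ρ₂ : Y → Prop) (Q : Space X) (ρ : Y → Prop) :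
    P.m₂ ρ * Q.I ≤ (glue P ρ₁ ρ₂ Q).m₂ (fun s => ρ s.1) := by
  unfold Space.m₂ Space.I
  rw [← cnt_glue_and]
  apply Space.cnt_mono
  rintro s ⟨⟨hG, hρ⟩, hV⟩
  refine ⟨?_, hρ⟩
  rw [glue_G₂]
  rintro (h | ⟨_, h⟩)
  · exact hG h
  · exact hV (Q.hG₂ _ h)

/-- **(INV) composes, far side** (C-041.md §10 (b)): (INV) for `(P, v)` and for `(Q, u″)` gives (INV) for the
glue at `u″`. -/
theorem INV_glue_right (P : Space Y) (ρ₁ ρ₂ : Y → Prop) (Q : Space X) (ρ₁' ρ₂' : X → Prop)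
    (hP₁ : P.I ≤ P.m₁ ρ₁) (hP₂ : P.I ≤ P.m₂ ρ₂) (hQ₁ : Q.I ≤ Q.m₁ ρ₁') (hQ₂ : Q.I ≤ Q.m₂ ρ₂') :
    (glue P ρ₁ ρ₂ Q).I ≤ (glue P ρ₁ ρ₂ Q).m₁ (fun s => ρ₁ s.1 ∧ ρ₁' s.2) ∧
      (glue P ρ₁ ρ₂ Q).I ≤ (glue P ρ₁ ρ₂ Q).m₂ (fun s => ρ₂ s.1 ∧ ρ₂' s.2) := by
  rw [I_glue, m₁_glue_right, m₂_glue_right]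
  exact ⟨mul_le_mul hP₁ hQ₁ Q.I_nonneg (P.m₁_nonneg ρ₁), mul_le_mul hP₂ hQ₂ Q.I_nonneg (P.m₂_nonneg ρ₂)⟩

/-- **(INV) composes, near side** (C-041.md §10 (b)): (INV) for `(P, u″)` gives (INV) for the glue at `u″`. -/
theorem INV_glue_left (P : Space Y) (ρ₁ ρ₂ : Y → Prop) (Q : Space X) (ρ₁'' ρ₂'' : Y → Prop)
    (hP₁ : P.I ≤ P.m₁ ρ₁'') (hP₂ : P.I ≤ P.m₂ ρ₂'') :
    (glue P ρ₁ ρ₂ Q).I ≤ (glue P ρ₁ ρ₂ Q).m₁ (fun s => ρ₁'' s.1) ∧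
      (glue P ρ₁ ρ₂ Q).I ≤ (glue P ρ₁ ρ₂ Q).m₂ (fun s => ρ₂'' s.1) := by
  rw [I_glue]
  exact ⟨(mul_le_mul_of_nonneg_right hP₁ Q.I_nonneg).trans (m₁_glue_left P ρ₁ ρ₂ Q ρ₁''),
    (mul_le_mul_of_nonneg_right hP₂ Q.I_nonneg).trans (m₂_glue_left P ρ₁ ρ₂ Q ρ₂'')⟩

end CutGlue

end PercRepro
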